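import Mathlib
import Summits.NavierStokesRegularity.NavierStokesRegularity.Theorems.WakeRatchetTailRatchetStall
import HarnessLib

/-!
# `WakeRatchet.TailRatchet` (stmt-NavierStokesRegularity-21808) — persistent firing passes to continuous
# limits of frames; the frame form of the stall kill criterion

Companion to `WakeRatchetTailRatchetStall` (MODEL lattice ODEs of Tao 2016 §4 in renormalised variables; nothing
here concerns the Navier–Stokes equations; stmt-21808 is neither proved nor refuted here).

The kill criterion `WakeRatchetStall.tailRatchet_false_of_persistentFiring` wants a uniformly bounded admissible
eternal solution in which infinitely many forward shells reach a fixed renormalised level at log-times `≥ σ₀`.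
Such solutions are meant to come out of COMPACTNESS: frames `V j : ℤ → ℝ → ℝ^m` of one blow-up solution
recentred at its firing log-times converge continuously (Arzelà–Ascoli, as in the tree's `FramesConverge` of
`WakeRatchetExtractionFrames`) to a limit `W`.  This file supplies the limit-side glue, generically and
def-free:

* `tendsto_subseq_of_seqConverge`: continuous convergence in the tree's sequence form
  (`u → σ ⟹ V j n (u j) → W n σ`) is inherited by every subsequence of frames (re-indexing by
  `Function.extend`);
* `persistentFiring_of_limit`: if, frame by frame (eventually in `j`), forward shell `n₀ + k` reaches level `c` at
  some log-time in the window `[σ₀, σ₀ + g k]` (a firing-gap bound, uniform in the frame), then the limit `W`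
  fires at level `c` in the same window for EVERY `k` (Bolzano–Weierstrass in the window + continuous
  convergence + continuity of the norm);
* `tailRatchet_false_of_firingFrames`: hence frames with uniform firing windows converging, at arbitrarily small
  scale ratios, to uniformly bounded admissible eternal solutions of E₂(R) tables refute `TailRatchet`.

What remains for door D4′ of the item's census is entirely on the Cauchy side (uniform bound, per-shell action,
post-firing decay and firing-gap bounds for the non-negative dyadic blow-up, and the extraction producing
`IsEternalVisc`/`UniformBound` limits) — not in print, not proved here.

HONEST FRAMING: elementary topology/bookkeeping; conditional refutation only; no verdict changes.
-/

noncomputable section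

set_option linter.dupNamespace false

namespace Summit.NavierStokesRegularity.NavierStokesRegularity.Theorems

namespace WakeRatchetStallLimit

open Filter Topology Set
open Literature.Analysis.FluidPDE Literature.Analysis.FluidPDE.TaoCascade
open Summit.NavierStokesRegularity.NavierStokesRegularity.Theses.WakeRatchet
open WakeRatchetStall

variable {m : ℕ}

/-! ## Continuous convergence along subsequences -/

/-- Re-indexing a convergent sequence along a strictly monotone `φ`: the extension `ũ` of `u` by the limit
value off the range of `φ` (so `ũ (φ j) = u j`) still converges to the same limit. [folklore] -/
theorem tendsto_extend_of_strictMono {φ : ℕ → ℕ} (hφ : StrictMono φ) {u : ℕ → ℝ} {σ : ℝ}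
    (hu : Tendsto u atTop (𝓝 σ)) :
    Tendsto (Function.extend φ u (fun _ => σ)) atTop (𝓝 σ) := by
  rw [tendsto_atTop_nhds] at hu ⊢
  intro U hσU hU
  obtain ⟨J, hJ⟩ := hu U hσU hU
  refine ⟨φ J, fun i hi => ?_⟩
  by_cases h : ∃ j, φ j = i
  · obtain ⟨j, rfl⟩ := h
    rw [hφ.injective.extend_apply]
    exact hJ j (hφ.le_iff_le.1 hi)
  · rw [Function.extend_apply' _ _ _ h]
    exact hσU

/-- **Continuous convergence is inherited by subsequences of frames.**  If `V j n (u j) → W n σ` whenever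
`u → σ` (the tree's sequence form of continuous convergence, cf. `FramesConverge`), then the same holds along
every strictly monotone subsequence `φ` of the frames. [folklore] -/
theorem tendsto_subseq_of_seqConverge {V : ℕ → ℤ → ℝ → Em m} {W : ℤ → ℝ → Em m}
    (hconv : ∀ (n : ℤ) (u : ℕ → ℝ) (σ : ℝ), Tendsto u atTop (𝓝 σ) →
      Tendsto (fun j => V j n (u j)) atTop (𝓝 (W n σ)))
    (n : ℤ) {φ : ℕ → ℕ} (hφ : StrictMono φ) {u : ℕ → ℝ} {σ : ℝ} (hu : Tendsto u atTop (𝓝 σ)) :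
    Tendsto (fun i => V (φ i) n (u i)) atTop (𝓝 (W n σ)) := by
  have h := (hconv n _ σ (tendsto_extend_of_strictMono hφ hu)).comp hφ.tendsto_atTop
  refine h.congr fun i => ?_
  simp only [Function.comp_apply, hφ.injective.extend_apply]

/-! ## Persistent firing passes to the limit -/

/-- **Persistent firing passes to continuous limits.**  Let frames `V j` converge continuously along
subsequences to `W` (shell by shell).  If for every `k`, eventually in the frame index `j`, the forward shell
`n₀ + k` of frame `j` reaches renormalised level `c` at a log-time in the window `[σ₀, σ₀ + g k]`, then the
limit reaches level `c` in the same window at every `k`.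
[cite: Tao2016AveragedNS, §4 (statement shape only); elementary (Bolzano–Weierstrass + continuity of the norm)] -/
theorem persistentFiring_of_limit {V : ℕ → ℤ → ℝ → Em m} {W : ℤ → ℝ → Em m}
    (hconv : ∀ (n : ℤ) (φ : ℕ → ℕ), StrictMono φ → ∀ (u : ℕ → ℝ) (σ : ℝ), Tendsto u atTop (𝓝 σ) →
      Tendsto (fun i => V (φ i) n (u i)) atTop (𝓝 (W n σ)))
    {c σ₀ : ℝ} {g : ℕ → ℝ} {n₀ : ℤ}
    (hfire : ∀ k : ℕ, ∀ᶠ j in atTop, ∃ σ : ℝ, σ₀ ≤ σ ∧ σ ≤ σ₀ + g k ∧ c ≤ ‖V j (n₀ + k) σ‖) :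
    ∀ k : ℕ, ∃ σ : ℝ, σ₀ ≤ σ ∧ σ ≤ σ₀ + g k ∧ c ≤ ‖W (n₀ + k) σ‖ := by
  intro k
  obtain ⟨J, hJ⟩ := Filter.eventually_atTop.1 (hfire k)
  -- firing log-times of the frames `J, J+1, …`
  choose τ hτ using fun j : ℕ => hJ (j + J) (Nat.le_add_left J j)
  have hmem : ∀ j, τ j ∈ Icc σ₀ (σ₀ + g k) := fun j => ⟨(hτ j).1, (hτ j).2.1⟩
  obtain ⟨σs, hσs, ψ, hψ, hlim⟩ := isCompact_Icc.tendsto_subseq hmem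
  -- the shifted subsequence of frames
  have hφ : StrictMono (fun i => ψ i + J) := fun a b hab => Nat.add_lt_add_right (hψ hab) J
  have hV := hconv (n₀ + k) (fun i => ψ i + J) hφ (τ ∘ ψ) σs hlim
  have hnorm : Tendsto (fun i => ‖V (ψ i + J) (n₀ + k) ((τ ∘ ψ) i)‖) atTop (𝓝 ‖W (n₀ + k) σs‖) :=
    hV.norm
  refine ⟨σs, hσs.1, hσs.2, ge_of_tendsto' hnorm fun i => ?_⟩
  exact (hτ (ψ i)).2.2

/-- The same with the tree's sequence form of continuous convergence (no subsequence in the hypothesis).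
[cite: Tao2016AveragedNS, §4 (statement shape only); elementary] -/
theorem persistentFiring_of_seqLimit {V : ℕ → ℤ → ℝ → Em m} {W : ℤ → ℝ → Em m}
    (hconv : ∀ (n : ℤ) (u : ℕ → ℝ) (σ : ℝ), Tendsto u atTop (𝓝 σ) →
      Tendsto (fun j => V j n (u j)) atTop (𝓝 (W n σ)))
    {c σ₀ : ℝ} {g : ℕ → ℝ} {n₀ : ℤ}
    (hfire : ∀ k : ℕ, ∀ᶠ j in atTop, ∃ σ : ℝ, σ₀ ≤ σ ∧ σ ≤ σ₀ + g k ∧ c ≤ ‖V j (n₀ + k) σ‖) :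
    ∀ k : ℕ, ∃ σ : ℝ, σ₀ ≤ σ ∧ σ ≤ σ₀ + g k ∧ c ≤ ‖W (n₀ + k) σ‖ :=
  persistentFiring_of_limit (fun n _ hφ _ _ hu => tendsto_subseq_of_seqConverge hconv n hφ hu) hfire

/-! ## The frame form of the kill criterion -/

/-- **Kill criterion for `TailRatchet`, frame form.**  If on a fixed spread `R ≥ 1`, at arbitrarily small scale
ratios, some E₂(R) table carries frames `V j` converging continuously (sequence form) to a uniformly bounded
admissible eternal solution `W` (any covariant viscosity), and frame by frame (eventually) every forward shell
`n₀ + k` fires at a fixed level `c > 0` inside a window `[σ₀, σ₀ + g k]`, then `TailRatchet` fails.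
[cite: Tao2016AveragedNS, §4 Thm. 4.2 (statement shape), §6.4; cell vocabulary] -/
theorem tailRatchet_false_of_firingFrames {R : ℝ} (hR : 1 ≤ R)
    (hF : ∀ ε : ℝ, 0 < ε → ∃ ε₀ : ℝ, 0 < ε₀ ∧ ε₀ ≤ ε ∧
      ∃ α : Fin 4 → Fin 4 → Fin 4 → ℤ × ℤ × ℤ → ℝ, InTableClass R α ∧
        ∃ (νh : ℝ) (W : ℤ → ℝ → Em 4) (V : ℕ → ℤ → ℝ → Em 4),
          IsEternalVisc ε₀ νh α W ∧ UniformBound W ∧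
          (∀ (n : ℤ) (u : ℕ → ℝ) (σ : ℝ), Tendsto u atTop (𝓝 σ) →
            Tendsto (fun j => V j n (u j)) atTop (𝓝 (W n σ))) ∧
          ∃ c : ℝ, 0 < c ∧ ∃ (n₀ : ℤ) (σ₀ : ℝ) (g : ℕ → ℝ),
            ∀ k : ℕ, ∀ᶠ j in atTop, ∃ σ : ℝ, σ₀ ≤ σ ∧ σ ≤ σ₀ + g k ∧ c ≤ ‖V j (n₀ + k) σ‖) :
    ¬ TailRatchet := by
  refine tailRatchet_false_of_persistentFiring hR fun ε hε => ?_
  obtain ⟨ε₀, hε₀, hle, α, hα, νh, W, V, hW, hU, hconv, c, hc, n₀, σ₀, g, hfire⟩ := hF ε hε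
  refine ⟨ε₀, hε₀, hle, α, hα, νh, W, hW, hU, c, hc, n₀, σ₀, fun K => ?_⟩
  obtain ⟨σ, hσ₀, -, hge⟩ := persistentFiring_of_seqLimit hconv hfire K
  exact ⟨K, le_rfl, σ, hσ₀, hge⟩

end WakeRatchetStallLimit

end Summit.NavierStokesRegularity.NavierStokesRegularity.Theorems

end
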